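import Literature.NumberTheory.GaloisRepresentations.ToLocalRestrictField
import Literature.NumberTheory.GaloisRepresentations.ResidualRepRestrict
import Literature.NumberTheory.GaloisRepresentations.OrdinaryGaloisRep
import HarnessLib

/-!
# Restriction of a Galois representation along `K ≤ K` is a change of frame

Topic `NumberTheory/GaloisRepresentations`.  Theorem-only file (no definition, no named fact, D-0026).
The tree's restriction map `absGaloisRestrict K K : Γ_K →ₜ* Γ_K` along the identity `K`-algebra
structure is an INNER automorphism of `Γ_K` (restriction is only well defined up to conjugacy,
`absGaloisRestrict_isConj_of_algHom_holds`; here the competing embedding is `id : K̄ → K̄`), so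
`ρ.restrictField K = ρ(σ₀) · ρ · ρ(σ₀)⁻¹` is a change of frame (`FramedGaloisRep.exists_restrictField_self_eq_conj`).
Consequently every property of `ρ.restrictField K` that is a frame invariant is the same property of
`ρ`, for THE SAME pinned Fontaine datum `fontainePstAdicCompletion w ℓ hw` of a place `w ∣ ℓ` (no base
change of `p`-adic Hodge data is involved, in contrast with a genuine extension `K'/K`, cf.
`ToLocalRestrictField`).  Used by the `K' = K` instance of potential-automorphy statements quantified
as `∃ K' ⊇ K, … (ρ.restrictField K') …` (summit `Langlands`, crux `StickelbergerDial.UnramifiedFermatWitness`):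

* residual representations do not see the frame of `r` (`IsResidualRepOf.conj_comp`,
  `FramedGaloisRep.isResidualRepOf_restrictField_self`: an integral model `P⁻¹ r P` of `r` is the integral model
  `(gP)⁻¹ (g r g⁻¹) (gP)` of `g r g⁻¹`);
* crystallinity and the labelled Hodge–Tate weights at `w ∣ ℓ` do not see it either
  (`FramedGaloisRep.isCrystallineFramed_and_labelledHodgeTateWeightsAt_restrictField_self`, from
  `isCrystallineFramed_conj_iff` / `labelledHodgeTateWeights_conj_eq`);

Everything is proved; axioms ⊆ {propext, Classical.choice, Quot.sound}.

References: [SerreAbelianLadic1968] J.-P. Serre, *Abelian ℓ-adic representations and elliptic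
curves* (1968), Ch. I §1.1 (lattices) and §2.1 (restriction well defined up to conjugation);
[MilneFT2022] J. S. Milne, *Fields and Galois Theory* v4.60, Ch. 7; [DarmonDiamondTaylor1995]
H. Darmon, F. Diamond, R. Taylor, *Fermat's Last Theorem*, §2.1 p. 54; [FontaineAsterisque223III]
J.-M. Fontaine, Astérisque 223 (1994), Exp. III §1.5, §5.1.
-/

noncomputable section

namespace Literature.NumberTheory.GaloisRepresentations

open Literature.NumberTheory.PAdicHodge Field IsDedekindDomain NumberField
open scoped MatrixGroups

/-! ### Residual representations do not see the frame -/

section Frame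

variable {F : Type*} [Field F] {O : ValuationSubring F} {n : ℕ}
variable {G : Type*} [Group G] {k : Type*} [Field k]

/-- An integral model of `ρ` is an integral model of the conjugate `g ρ g⁻¹` (frame `gP` instead of
`P`). [cite: SerreAbelianLadic1968, Ch. I §1.1] -/
theorem IsIntegralModelOf.conj_comp {ρ : G →* GL (Fin n) F} {ρ₀ : G →* GL (Fin n) O}
    (h : IsIntegralModelOf ρ ρ₀) (g : GL (Fin n) F) :
    IsIntegralModelOf ((MulAut.conj g).toMonoidHom.comp ρ) ρ₀ := by
  obtain ⟨P, hP⟩ := h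
  refine ⟨g * P, fun x => ?_⟩
  rw [hP x, MonoidHom.comp_apply, MulEquiv.coe_toMonoidHom, MulAut.conj_apply, mul_inv_rev]
  group

/-- A reduction of `ρ` is a reduction of the conjugate `g ρ g⁻¹`.
[cite: DarmonDiamondTaylor1995, §2.1, p. 54] -/
theorem IsReductionOf.conj_comp {ι : IsLocalRing.ResidueField O →+* k} {ρ : G →* GL (Fin n) F}
    {τ : G →* GL (Fin n) k} (h : IsReductionOf ι ρ τ) (g : GL (Fin n) F) :
    IsReductionOf ι ((MulAut.conj g).toMonoidHom.comp ρ) τ := by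
  obtain ⟨ρ₀, Q, hmodel, hQ⟩ := h
  exact ⟨ρ₀, Q, hmodel.conj_comp g, hQ⟩

/-- **A residual representation of `ρ` is a residual representation of every conjugate `g ρ g⁻¹`**
(the semisimplified reduction is an isomorphism invariant of `ρ`).
[cite: DarmonDiamondTaylor1995, §2.1, p. 54] [cite: ACCGHLNSTT2023, §1 (Notation)] -/
theorem IsResidualRepOf.conj_comp {ι : IsLocalRing.ResidueField O →+* k} {ρ : G →* GL (Fin n) F}
    {τ : G →* GL (Fin n) k} (h : IsResidualRepOf ι ρ τ) (g : GL (Fin n) F) :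
    IsResidualRepOf ι ((MulAut.conj g).toMonoidHom.comp ρ) τ := by
  obtain ⟨τ₀, hred, hss⟩ := h
  exact ⟨τ₀, hred.conj_comp g, hss⟩

end Frame

/-! ### `r.restrictField K` is a change of frame -/

section Self

variable {K : Type} [Field K] {A : Type*} [CommRing A] [TopologicalSpace A] [IsTopologicalRing A]
  {n : ℕ}

/-- **Restriction along `K ≤ K` is conjugation**: `absGaloisRestrict K K σ = σ₀⁻¹ σ σ₀` for one
`σ₀ ∈ Γ_K` (the case `ι' = id`, `r' = id` of `absGaloisRestrict_isConj_of_algHom_holds`).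
[cite: MilneFT2022, Ch. 7 (the absolute Galois group)] -/
theorem exists_absGaloisRestrict_self_eq_conj :
    ∃ σ₀ : absoluteGaloisGroup K, ∀ σ, absGaloisRestrict K K σ = σ₀⁻¹ * σ * σ₀⁻¹⁻¹ := by
  obtain ⟨σ₀, hσ₀⟩ := absGaloisRestrict_isConj_of_algHom_holds K K
    (AlgHom.id K (AlgebraicClosure K)) id (fun _ _ => rfl)
  refine ⟨σ₀, fun σ => ?_⟩
  have h := hσ₀ σ
  simp only [id] at h
  rw [inv_inv]
  calc absGaloisRestrict K K σ = σ₀⁻¹ * (σ₀ * absGaloisRestrict K K σ * σ₀⁻¹) * σ₀ := by group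
    _ = σ₀⁻¹ * σ * σ₀ := by rw [← h]

/-- **`r|_{Γ_K}` along `K ≤ K` is a change of frame of `r`**: `r.restrictField K = r(σ₀) r r(σ₀)⁻¹`
for one `σ₀ ∈ Γ_K`. [cite: SerreAbelianLadic1968, Ch. I §2.1] -/
theorem FramedGaloisRep.exists_restrictField_self_eq_conj (ρ : FramedGaloisRep K A n) :
    ∃ σ₀ : absoluteGaloisGroup K, ρ.restrictField K = FramedRep.conj (ρ σ₀) ρ := by
  obtain ⟨σ₀, hσ₀⟩ := exists_absGaloisRestrict_self_eq_conj (K := K)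
  refine ⟨σ₀⁻¹, ?_⟩
  have h := FramedRep.comp_eq_conj_of_forall_eq ρ (f₁ := absGaloisRestrict K K)
    (f₂ := ContinuousMonoidHom.id _) (τ := σ₀⁻¹) (fun σ => by simpa using hσ₀ σ)
  have hid : ρ.comp (ContinuousMonoidHom.id _) = ρ := ContinuousMonoidHom.ext fun _ => rfl
  rw [hid] at h
  exact h

variable {ℓ : ℕ} [Fact ℓ.Prime] {k : Type*} [Field k]

/-- **A residual representation of `r` is a residual representation of `r|_{Γ_K}`** (restriction
along `K ≤ K`; no semisimplicity hypothesis, unlike a genuine restriction, because this one is a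
frame change). [cite: DarmonDiamondTaylor1995, §2.1, p. 54] [cite: SerreAbelianLadic1968, Ch. I §2.1] -/
theorem FramedGaloisRep.isResidualRepOf_restrictField_self {ρ : FramedGaloisRep K (PadicAlgCl ℓ) n}
    {ι : padicAlgClResidueField ℓ →+* k} {τ : absoluteGaloisGroup K →* GL (Fin n) k}
    (h : ρ.IsResidualRepOf ι τ) : (ρ.restrictField K).IsResidualRepOf ι τ := by
  obtain ⟨σ₀, hσ₀⟩ := ρ.exists_restrictField_self_eq_conj
  rw [hσ₀]
  exact h.conj_comp (ρ σ₀)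

end Self

/-! ### The analytic clause at `w ∣ ℓ` for `r|_{Γ_K}` and the same pinned datum -/

section Analytic

variable {K : Type} [Field K] [NumberField K] {ℓ : ℕ} [Fact ℓ.Prime] {n : ℕ}

/-- **Crystallinity and labelled Hodge–Tate weights at `w ∣ ℓ` pass from `r` to `r|_{Γ_K}` for THE
SAME pinned Fontaine datum** `fontainePstAdicCompletion w ℓ hw` (restriction along `K ≤ K` is a frame
change `exists_restrictField_self_eq_conj`; both clauses are frame invariant,
`isCrystallineFramed_conj_iff`, `labelledHodgeTateWeights_conj_eq`; `FramedGaloisRep.toLocal_conj` of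
`OrdinaryGaloisRep`).  (This is the `w ∣ ℓ` clause of
hypothesis (2) of ACC+ Thm. 6.1.1 for `r|_{Γ_K}` from the same clause for `r`, same datum.)
[cite: FontaineAsterisque223III, Exp. III §1.5 and §5.1] [cite: SerreAbelianLadic1968, Ch. I §2.1] -/
theorem FramedGaloisRep.isCrystallineFramed_and_labelledHodgeTateWeightsAt_restrictField_self
    (r : FramedGaloisRep K (PadicAlgCl ℓ) n) (S : Multiset ℤ)
    (h : ∀ (v : HeightOneSpectrum (𝓞 K)) (hv : ((ℓ : ℕ) : 𝓞 K) ∈ v.asIdeal),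
      (fontainePstAdicCompletion v ℓ hv).IsCrystallineFramed (r.toLocal v) ∧
        (letI := (fontainePstAdicCompletion v ℓ hv).algebra
         ∀ τ' : v.adicCompletion K →ₐ[ℚ_[ℓ]] PadicAlgCl ℓ,
           r.labelledHodgeTateWeightsAt v (fontainePstAdicCompletion v ℓ hv).algebra
             (fontainePstAdicCompletion v ℓ hv).𝔅 τ'.toRingHom = S))
    (w : HeightOneSpectrum (𝓞 K)) (hw : ((ℓ : ℕ) : 𝓞 K) ∈ w.asIdeal) :
    (fontainePstAdicCompletion w ℓ hw).IsCrystallineFramed ((r.restrictField K).toLocal w) ∧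
      (letI := (fontainePstAdicCompletion w ℓ hw).algebra
       ∀ τ'' : w.adicCompletion K →ₐ[ℚ_[ℓ]] PadicAlgCl ℓ,
         (r.restrictField K).labelledHodgeTateWeightsAt w (fontainePstAdicCompletion w ℓ hw).algebra
           (fontainePstAdicCompletion w ℓ hw).𝔅 τ''.toRingHom = S) := by
  obtain ⟨σ₀, hσ₀⟩ := r.exists_restrictField_self_eq_conj
  obtain ⟨hcr, hHT⟩ := h w hw
  refine ⟨?_, fun τ'' => ?_⟩
  · rw [hσ₀, FramedGaloisRep.toLocal_conj, PstWeilDeligneData.isCrystallineFramed_conj_iff]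
    exact hcr
  · rw [FramedGaloisRep.labelledHodgeTateWeightsAt_def, hσ₀, FramedGaloisRep.toLocal_conj]
    rw [PstWeilDeligneData.labelledHodgeTateWeights_conj_eq]
    have := hHT τ''
    rw [FramedGaloisRep.labelledHodgeTateWeightsAt_def] at this
    exact this

end Analytic

end Literature.NumberTheory.GaloisRepresentations

end
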